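import Summits.HodgeConjecture.CorCM.MumfordTateRankSevenTypeThree
import HarnessLib

/-!
# The rung `dim MT(H¹(X)) = 7` with `ℚ`-SIMPLE Hodge Lie algebra, V: in the type-III position `X ∼ B^{m+1}` is isotypic,
# `Z(End⁰B) = ℚ`, `4 · dim_ℚ End⁰B = (dim B)²`, `dim B ∈ {2, 4, 8}`

COR-CM (cell `pub-hodgecm2`, seat `b27` gen 41, count-neutral lane MT-RANK-SEVEN-TYPEIII; theorems only, no definition, no
named fact; UNCONDITIONAL — nothing here uses or asserts HC_CM).  Sequel of `CorCM/MumfordTateRankSevenTypeThree`: there,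
for `0 < dim X`, `𝔷 = 0`, `dim MT(H¹X) = 7`, `Lie Hg(H¹X)` `ℚ`-simple and `dim 𝔤⁺ = dim 𝔤⁻ = 1`, one has `dim X = 4k`,
`dim_ℚ End⁰X = 4k²`, `Z(End⁰X) = ℚ`.

* **`exists_isIsogenous_power_of_isSimple_of_finrank_gradingPlus_eq_one`** — `X ∼ B^{m+1}` is ISOTYPIC (`Z(End⁰X)` is the
  field `ℚ`; along `X ∼ ⨁ᵢ Bᵢ^{nᵢ+1}` the centre is `∏ᵢ Z(End⁰Bᵢ)`, `CorCM/EndAlgebraCenterAlgebra`, of dimension `≥ #i`),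
  `B` simple with `Z(End⁰B) = ℚ`, and BY ARITHMETIC ALONE (`dim End⁰X = (m+1)² dim End⁰B = 4k²`,
  `dim X = (m+1) dim B = 4k`, `dim End⁰B ∣ 2 dim B`): `4 · dim_ℚ End⁰B = (dim B)²` and
  `(dim B, dim_ℚ End⁰B) ∈ {(2, 1), (4, 4), (8, 16)}`.  Moonen–Zarhin (2.3) Type III is `(4, 4)`: `B` a simple abelian
  FOURFOLD whose endomorphism algebra is a (definite) quaternion algebra over `ℚ`.  The two other pairs are phantoms of
  the method: `(2, 1)` (a power of a surface with `End⁰ = ℚ`, whose Hodge group is `Sp₄` of rank `11`) is excluded by the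
  classification of Hodge groups of abelian surfaces and `(8, 16)` by Albert's classification — neither is in the tree.

## References

* [MoonenZarhin1999LowDim] B. Moonen, Yu. Zarhin, *Hodge classes on abelian varieties of low dimension*, Math. Ann.
  315 (1999), §2 and (2.3) (Type III).
* [MumfordAV1970] D. Mumford, *Abelian Varieties* (1970), §19 Cor. 1–2 of Thm. 1 (pp. 173–174), §21.
-/

noncomputable section

open scoped TensorProduct
open CategoryTheory CategoryTheory.Limits Module

namespace Summit.HodgeConjecture.CorCM

open Literature.AlgebraicGeometry.Motives
open Literature.AlgebraicGeometry.Motives.AbelianVariety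
open Literature.AlgebraicGeometry.Motives.HodgeStructure
open Literature.AlgebraicGeometry.HodgeTheory

variable [HodgeTensorFacts.{0, 0}] {X : AbelianVariety ℂ} {n : ℕ}

/-- **`X ∼ B^{m+1}` with `B` simple, `Z(End⁰B) = ℚ`, `4 dim_ℚ End⁰B = (dim B)²` and `(dim B, dim_ℚ End⁰B) ∈ {(2,1), (4,4),
(8,16)}`** — for `0 < dim X`, `𝔷 = 0`, `dim MT(H¹X) = 7`, `Lie Hg(H¹X)` `ℚ`-simple and `dim 𝔤⁺ = dim 𝔤⁻ = 1` (the type-III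
position).  Also recorded: `X.dim = (m+1)·dim B = 4k`, `dim End⁰X = (m+1)² dim End⁰B = 4k²`.
[cite: MoonenZarhin1999LowDim, §2 and (2.3)] [cite: MumfordAV1970, §19 Cor. 1–2 of Thm. 1 (pp. 173–174) and §21] -/
theorem exists_isIsogenous_power_of_isSimple_of_finrank_gradingPlus_eq_one (hX : IsSmoothProjective n X.X)
    (h0 : 0 < X.dim)
    (hz : haveI := BettiUniverse.finite hX 1
      (BettiUniverse.hodge exists_isReal_hodgeModel_holds hX 1).hodgeLie ⊓
        Subalgebra.toSubmodule (BettiUniverse.hodge exists_isReal_hodgeModel_holds hX 1).endAlg = ⊥)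
    (h7 : haveI := BettiUniverse.finite hX 1
      (BettiUniverse.hodge exists_isReal_hodgeModel_holds hX 1).mtRank = 7)
    (hsimple : haveI := BettiUniverse.finite hX 1
      letI : LieRing (Module.End ℚ (bettiCohomology X.X 1)) := LieRing.ofAssociativeRing
      ∀ 𝔏 : LieSubalgebra ℚ (Module.End ℚ (bettiCohomology X.X 1)),
        𝔏.toSubmodule = (BettiUniverse.hodge exists_isReal_hodgeModel_holds hX 1).hodgeLie → LieAlgebra.IsSimple ℚ 𝔏)
    {S : Type} [Fintype S] [DecidableEq S] {deg : S → ℤ} (e : Module.Basis S ℂ (ℂ ⊗[ℚ] bettiCohomology X.X 1))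
    (hF : ∀ a, (BettiUniverse.hodge exists_isReal_hodgeModel_holds hX 1).F a = Submodule.span ℂ (e '' {σ | a ≤ deg σ}))
    (hFc : ∀ a, complexConj ((BettiUniverse.hodge exists_isReal_hodgeModel_holds hX 1).F a) =
      Submodule.span ℂ (e '' {σ | deg σ ≤ ((1 : ℕ) : ℤ) - a}))
    (hp1 : haveI := BettiUniverse.finite hX 1
      Module.finrank ℂ ((BettiUniverse.hodge exists_isReal_hodgeModel_holds hX 1).hodgeLieC ⊓ Module.End.eigenspace
        (LinearMap.mulLeft ℂ (gradingEnd e deg) - LinearMap.mulRight ℂ (gradingEnd e deg)) 1 : Submodule ℂ _) = 1)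
    (hm1 : haveI := BettiUniverse.finite hX 1
      Module.finrank ℂ ((BettiUniverse.hodge exists_isReal_hodgeModel_holds hX 1).hodgeLieC ⊓ Module.End.eigenspace
        (LinearMap.mulLeft ℂ (gradingEnd e deg) - LinearMap.mulRight ℂ (gradingEnd e deg)) (-1) : Submodule ℂ _) = 1) :
    ∃ (B : AbelianVariety ℂ) (m k : ℕ), B.IsSimple ∧ 0 < B.dim ∧ IsIsogenous X (⨁ fun _ : Fin (m + 1) => B) ∧ 0 < k ∧
      X.dim = 4 * k ∧ X.dim = (m + 1) * B.dim ∧ Module.finrank ℚ X.endAlgebra = 4 * k ^ 2 ∧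
      Module.finrank ℚ X.endAlgebra = (m + 1) ^ 2 * Module.finrank ℚ B.endAlgebra ∧
      Module.finrank ℚ (Subalgebra.center ℚ B.endAlgebra) = 1 ∧
      4 * Module.finrank ℚ B.endAlgebra = B.dim ^ 2 ∧
      ((B.dim = 2 ∧ Module.finrank ℚ B.endAlgebra = 1) ∨ (B.dim = 4 ∧ Module.finrank ℚ B.endAlgebra = 4) ∨
        (B.dim = 8 ∧ Module.finrank ℚ B.endAlgebra = 16)) := by
  classical
  obtain ⟨k, hk0, hdimX, hdimE, hcenX, hZ1⟩ :=
    finrank_endAlgebra_of_isSimple_of_finrank_gradingPlus_eq_one hX h0 hz h7 hsimple e hF hFc hp1 hm1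
  haveI : Nontrivial X.endAlgebra := Module.nontrivial_of_finrank_pos (R := ℚ) (by rw [hdimE]; positivity)
  -- the centre `ℚ` has no zero-divisors
  have hnzd : ∀ z ∈ Subalgebra.center ℚ X.endAlgebra, ∀ w ∈ Subalgebra.center ℚ X.endAlgebra, z * w = 0 → z = 0 ∨ w = 0 := by
    intro z hz' w hw hzw
    rw [hcenX, Algebra.mem_bot] at hz' hw
    obtain ⟨a, rfl⟩ := hz'
    obtain ⟨b, rfl⟩ := hw
    rw [← map_mul, map_eq_zero_iff _ (algebraMap ℚ X.endAlgebra).injective, mul_eq_zero] at hzw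
    rcases hzw with h | h
    · exact Or.inl (by rw [h, map_zero])
    · exact Or.inr (by rw [h, map_zero])
  -- the isotypic decomposition and the centre as a product of fields
  obtain ⟨r, B, nB, hS, hd, -, hXB, ⟨eZ⟩, hZF⟩ := CMProductEnd.exists_center_endAlgebra_algEquiv_pi X
  -- exactly one isotypic component: no zero-divisors in `Z(End⁰X)`
  have hr : r = 1 := by
    rcases r with _ | _ | r
    · exfalso
      haveI : Subsingleton (∀ i : Fin 0, Subalgebra.center ℚ (B i).endAlgebra) := inferInstance
      haveI : Subsingleton (Subalgebra.center ℚ X.endAlgebra) := eZ.toEquiv.subsingleton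
      rw [Module.finrank_zero_of_subsingleton] at hZ1
      exact absurd hZ1 (by norm_num)
    · rfl
    · exfalso
      haveI : ∀ i, Nontrivial (Subalgebra.center ℚ (B i).endAlgebra) := fun i =>
        (letI := (hZF i).toField; inferInstance)
      set u : ∀ i : Fin (r + 2), Subalgebra.center ℚ (B i).endAlgebra := Pi.single 0 1 with hu
      set v : ∀ i : Fin (r + 2), Subalgebra.center ℚ (B i).endAlgebra := Pi.single 1 1 with hv
      have h01 : (0 : Fin (r + 2)) ≠ 1 := Fin.ne_of_val_ne (by simp)
      have huv : u * v = 0 := by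
        funext i
        rw [Pi.mul_apply, Pi.zero_apply, hu, hv]
        by_cases hi : i = 0
        · rw [hi, Pi.single_eq_of_ne h01, mul_zero]
        · rw [Pi.single_eq_of_ne hi, zero_mul]
      have hu0 : u ≠ 0 := fun h => by
        have h' := congr_fun h 0
        rw [hu, Pi.single_eq_same, Pi.zero_apply] at h'
        exact one_ne_zero h'
      have hv0 : v ≠ 0 := fun h => by
        have h' := congr_fun h 1
        rw [hv, Pi.single_eq_same, Pi.zero_apply] at h'
        exact one_ne_zero h'
      have h0' : eZ.symm u * eZ.symm v = 0 := by rw [← map_mul, huv, map_zero]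
      have h := hnzd (eZ.symm u) (eZ.symm u).2 (eZ.symm v) (eZ.symm v).2 (congrArg Subtype.val h0')
      rcases h with h | h
      · exact hu0 (eZ.symm.injective (Subtype.ext (by rw [h, map_zero]; rfl)))
      · exact hv0 (eZ.symm.injective (Subtype.ext (by rw [h, map_zero]; rfl)))
  subst hr
  -- `X ∼ (B 0)^{m+1}`
  set m := nB 0 with hm
  let ι0 : (⨁ fun i : Fin 1 => ⨁ fun _ : Fin (nB i + 1) => B i) ≅ ⨁ fun _ : Fin (nB 0 + 1) => B 0 :=
    biproductUniqueIso (fun i : Fin 1 => ⨁ fun _ : Fin (nB i + 1) => B i)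
  have hX0 : IsIsogenous X (⨁ fun _ : Fin (m + 1) => B 0) := hXB.trans ⟨ι0.hom, isIsogeny_hom_of_iso ι0⟩
  obtain ⟨e0⟩ := hX0.nonempty_endAlgebra_algEquiv
  have hdimXB : X.dim = (m + 1) * (B 0).dim := by
    obtain ⟨f, hf⟩ := hX0
    rw [dim_eq_of_isIsogeny hf, AndreRiemann.dim_biproduct_const]
  have hEXB : Module.finrank ℚ X.endAlgebra = (m + 1) ^ 2 * Module.finrank ℚ (B 0).endAlgebra := by
    rw [hX0.finrank_endAlgebra_eq, EndAlgebraPower.finrank_endAlgebra_biproduct]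
  -- `Z(End⁰ B) ≃ₐ Z(End⁰ X)`
  obtain ⟨e1, -⟩ := CMProductEnd.nonempty_algEquiv_center_of_algEquiv e0
  obtain ⟨e2, -⟩ := CMProductEnd.nonempty_algEquiv_center_endAlgebra_biproduct (B := B 0) (m := m + 1) (Nat.succ_pos m)
  have hZB : Module.finrank ℚ (Subalgebra.center ℚ (B 0).endAlgebra) = 1 := by
    rw [← (e1.trans e2.symm).toLinearEquiv.finrank_eq]; exact hZ1
  -- arithmetic: `g = dim B`, `mB = dim_ℚ End⁰B`
  obtain ⟨g, hg⟩ : ∃ g, (B 0).dim = g := ⟨_, rfl⟩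
  obtain ⟨mB, hmB⟩ : ∃ mB, Module.finrank ℚ (B 0).endAlgebra = mB := ⟨_, rfl⟩
  have hmB2g : mB ∣ 2 * g := by
    rw [← hmB, ← hg]
    exact Literature.AlgebraicGeometry.ComplexMultiplication.finrank_endAlgebra_dvd_two_mul_dim (hS 0)
  have hg0 : 0 < g := hg ▸ hd 0
  have hA : (m + 1) ^ 2 * mB = 4 * k ^ 2 := by rw [← hmB, ← hEXB, hdimE]
  have hBsum : (m + 1) * g = 4 * k := by rw [← hg, ← hdimXB, hdimX]
  -- `4 mB = g²`
  have h4 : 4 * mB = g ^ 2 := by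
    have h : (m + 1) ^ 2 * (4 * mB) = (m + 1) ^ 2 * g ^ 2 := by
      rw [← mul_pow, hBsum, mul_left_comm, hA]; ring
    exact Nat.eq_of_mul_eq_mul_left (by positivity) h
  -- `g ∣ 8`
  have hg8 : g ∣ 8 := by
    obtain ⟨c, hc⟩ := hmB2g
    refine ⟨c, ?_⟩
    have h : g * 8 = g * (g * c) := by nlinarith [hc, h4]
    have h' := Nat.eq_of_mul_eq_mul_left hg0 h
    rw [h']
  have hgle : g ≤ 8 := Nat.le_of_dvd (by norm_num) hg8
  have hcases : (g = 2 ∧ mB = 1) ∨ (g = 4 ∧ mB = 4) ∨ (g = 8 ∧ mB = 16) := by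
    interval_cases g <;> omega
  refine ⟨B 0, m, k, hS 0, hd 0, hX0, hk0, hdimX, hdimXB, hdimE, hEXB, hZB, ?_, ?_⟩
  · rw [hmB, hg, h4]
  · rw [hg, hmB]; exact hcases

end Summit.HodgeConjecture.CorCM

end
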